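import Mathlib
import HarnessLib
import Summits.ValiantsHypothesis.ValiantsHypothesis.Theorems.MonotoneRestorationOrbitRestorationQPBooleanWidthCollapse
import Summits.ValiantsHypothesis.ValiantsHypothesis.Theorems.MonotoneRestorationOrbitRestorationQPAbsorbableHypothesis

/-!
# Route MonotoneRestoration, crux `OrbitRestorationQP` (stmt-18293) — BOOLEAN-VANISHING NORMAL FORM OF THE CRUX
# (helper, def-free)

* `orbitRestorationQP_iff_booleanVanishing` — **L1 is equivalent to its restriction to the matrix-symmetric `VP` families that
  VANISH AT EVERY `0/1` POINT** (instance of `orbitRestorationQP_iff_of_absorbable`, p827821, with the multiplier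
  `E_n = Π_{j ≤ n²}(U_n − j)` of `…OrbitRestorationQPBooleanWidthCollapse.lean`, p827686).

Reading.  To PROVE L1 it suffices to restore Boolean-invisible families; and if L1 is FALSE, there is a counterexample (`E·f`) on which
every `0/1`-point method — the Boolean counting-width pipeline `not_qpOrbitSymmetric_of_polylogSeparating`, the simple-graph halves `W₁`,
`H₁` — is SILENT (all values `0`).  What survives on such families is exactly the GLUED format (`…OrbitRestorationQPGluedKill.lean`,
p827438): at a glued point `2·J + 1_X` the multiplier `E` is a non-zero constant on `≡^{C^2}`-classes (it only reads the number of
ones), so glued separation of `f` transfers to `E·f`.  Honest label: a normal form; nothing closed; VP ≠ VNP untouched. [folklore]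
-/

-- `Summit.ValiantsHypothesis.ValiantsHypothesis.…` is the tree's mandated namespace (Sub = Summit).
set_option linter.dupNamespace false

noncomputable section

open scoped Classical

namespace Summit.ValiantsHypothesis.ValiantsHypothesis.Theorems

namespace BooleanWidthCollapse

open MvPolynomial Finset
open Summit.ValiantsHypothesis.ValiantsHypothesis.Theses.MonotoneRestoration
open Literature.Computability.AlgebraicComplexity
open OrbitRestorationQPDepthThreeRung LevelStructure

/-- **BOOLEAN-VANISHING NORMAL FORM**: `OrbitRestorationQP` holds iff it holds for the matrix-symmetric `VP` families vanishing at
every `0/1` point. [folklore] -/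
theorem orbitRestorationQP_iff_booleanVanishing :
    OrbitRestorationQP ↔
      ∀ f : (n : ℕ) → MvPolynomial (Fin n × Fin n) ℂ,
        (∀ (n : ℕ) (σ τ : Equiv.Perm (Fin n)),
          MvPolynomial.rename (fun p : Fin n × Fin n => (σ p.1, τ p.2)) (f n) = f n) →
        IsVPFamily f →
        (∀ (n : ℕ) (S : Set (Fin n × Fin n)), eval (Set.indicator S (1 : Fin n × Fin n → ℂ)) (f n) = 0) →
        ∃ c : ℕ, ∀ n : ℕ, ∃ (G : Type) (_ : Fintype G)
          (C : LabelledArithCircuit ℂ (Fin n × Fin n) Unit G),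
          C.IsSymmetric (Equiv.Perm (Fin n)) ∧ C.eval (C.output ()) = f n ∧
            C.orbitSize (Equiv.Perm (Fin n)) ≤ 2 ^ ((Nat.log 2 n + c) ^ c) :=
  orbitRestorationQP_iff_of_absorbable
    (fun f => ∀ (n : ℕ) (S : Set (Fin n × Fin n)), eval (Set.indicator S (1 : Fin n × Fin n → ℂ)) (f n) = 0)
    (fun n => ∏ j ∈ range (n * n + 1), (U n - C (j : ℂ)))
    rename_E isVPFamily_E ⟨5, qpOrbitRestorable_E⟩ (fun _ _ => (2 : ℂ)) (fun _ _ _ => rfl)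
    (fun n hn => eval_two_E_ne_zero hn)
    (fun h _ _ n S => by simp only [map_mul, eval_indicator_E, zero_mul])

end BooleanWidthCollapse

end Summit.ValiantsHypothesis.ValiantsHypothesis.Theorems

end
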